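import Literature.AlgebraicGeometry.Modules.CechRefineMultiplicative
import Literature.AlgebraicGeometry.Modules.CechPullbackSystemHom
import Literature.Algebra.Homology.OrderedCechSystemRefineMap
import HarnessLib

/-!
# Pull-back along a morphism of schemes is multiplicative on ordered Čech cohomology classes of `𝒪`
# (The Stacks Project, Tags 01FG, 01FP; Godement II §6.6)

Topic `AlgebraicGeometry/Modules`; namespace `Literature.AlgebraicGeometry.Modules`.  PROOF file (theorems only; no definition,
no named fact, no instance, no notation, no `sorry`).  Cell `hodgecm-mathlib` FLOOR 0, P1 sub-line F-11, packet (iv)∕J3, brick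
**(G1-a)′** (F0P1b-p01 (g2)); consumers: F-J3b (F0P1b-p02 (g2)) stubs `stub_pTwo_mul` ∕ `stub_mT_mul` ∕ `stub_swS_mul`
(and, uniformly, the monotone ones `stub_pOne_mul` ∕ `stub_rT_mul` ∕ `stub_iOne_mul` ∕ `stub_iTwo_mul`), (iv-4) (F0P1b-p04).

Let `f : Y ⟶ X` be a morphism of schemes, `ρ_X : A → Γ(X, 𝒪_X)` and `ρ_Y = f^♯ ∘ ρ_X` compatible `A`-structures,
`𝓤 = (U_i)_{i ∈ ι}` a FINITE family of opens of `X` which covers `X` and all of whose non-empty finite intersections are affine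
(the Leray hypothesis), `𝓥 = (V_c)_{c ∈ ι′}` any family of opens of `Y` and `θ : ι′ → ι` an ADMISSIBLE index map
(`V_c ⊆ f⁻¹ U_{θ c}`) — no monotonicity is assumed.  ★ `Modules/CechPullbackSystemHom` packages `f^♯` followed by restriction
as the morphism of module Čech systems `pullbackSystemHom f 𝓤 𝓥 θ … : θ^*S_X ⟶ S_Y` (`S_X := (Γ(𝒪_X, U_s))_s`,
`S_Y := (Γ(𝒪_Y, V_{s′}))_{s′}`), and ★ `Algebra/Homology/OrderedCechSystemRefineMap` packages the ordered refinement along `θ`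
as the cochain map `refineComplexMap θ φ : Č(S_X) ⟶ Č(S_Y)`; Mathlib's `HomologicalComplex.homologyMap` of the composite is the
pull-back `f^* : Ȟⁿ(𝓤, 𝒪_X) → Ȟⁿ(𝓥, 𝒪_Y)` on ordered Čech classes.  This file records that `f^*` is a map of graded rings for
the class-level cup product ★ `OrderedCech.cupH` of the multiplication pairings ★ `mulPairing`:

* §1 **`homologyMap_pullback_cupH`** — `f^*(x ⌣ y) = f^*x ⌣ f^*y` for `x ∈ Ȟᵖ(𝓤, 𝒪_X)`, `y ∈ Ȟᵠ(𝓤, 𝒪_X)`, `p + q = n`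
  (★ `homologyMap_cupH` of `Modules/CechRefineMultiplicative` — the cup defect of a non-monotone refinement is a coboundary by
  Leray on the source cover — specialised to the characterised cochain map `refineComplexMap` (`refineComplexMap_f_apply`) and to
  the multiplicativity `pullbackSystemHom_mulPairing` of `f^♯`);
* §2 `homologyMap_comp_lift_cupH` — the same identity for the linear maps `Ȟᵖ ⊗ Ȟᵠ → Ȟⁿ` (`TensorProduct.lift` of the
  cup product intertwines `f^* ⊗ f^*` and `f^*`), the shape in which surjectivity statements `Ȟ¹ ⊗ Ȟ¹ ↠ Ȟ²` are transported.

## References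
* The Stacks Project, Tag 01FG (Čech complex, refinements and functoriality), Tag 01FP (cup product). [StacksProject]
* R. Godement, *Topologie algébrique et théorie des faisceaux* (1958), II §6.6 (multiplicative structure, functoriality).
  [Godement1958]
* U. Görtz, T. Wedhorn, *Algebraic Geometry II* (2023), (21.29), Def. 21.68 (p. 180), Thm. 22.9 (p. 236). [GortzWedhorn2023]
-/

open CategoryTheory CategoryTheory.Limits HomologicalComplex AlgebraicGeometry TopologicalSpace
open scoped TensorProduct

set_option backward.isDefEq.respectTransparency false -- `ModuleCat`-valued functors (as in ★ `OrderedCechSystem`)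

noncomputable section

namespace Literature.AlgebraicGeometry.Modules

open Literature.Algebra.Homology Literature.Algebra.Homology.OrderedCech

variable {X Y : Scheme.{0}} (f : Y ⟶ X) {ι ι' : Type} [LinearOrder ι] [Fintype ι] [LinearOrder ι'] (U : ι → X.Opens)
  (V : ι' → Y.Opens) (θ : ι' → ι) (hθ : ∀ c, V c ≤ f ⁻¹ᵁ U (θ c)) {A : Type} [CommRing A] (ρX : A →+* Γ(X, ⊤))
  (ρY : A →+* Γ(Y, ⊤)) (hρ : ∀ a, ρY a = f.appTop (ρX a))

/-! ## §1 `f^*` is multiplicative on classes -/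

/-- **Pull-back along a morphism of schemes is multiplicative on ordered Čech cohomology classes of the structure sheaf.**
For `f : Y ⟶ X`, compatible `A`-structures `ρ_Y = f^♯ ∘ ρ_X`, a finite cover `𝓤` of `X` with affine non-empty finite
intersections, a family of opens `𝓥` of `Y` and an admissible index map `θ` (`V_c ⊆ f⁻¹ U_{θ c}`, NOT necessarily monotone),
the pull-back `f^* = H(refineComplexMap θ (pullbackSystemHom f 𝓤 𝓥 θ …))` satisfies `f^*(x ⌣ y) = f^* x ⌣ f^* y` for the
class-level cup products ★ `cupH (mulPairing 𝓤 ρ_X)` and ★ `cupH (mulPairing 𝓥 ρ_Y)`, in all bidegrees `p + q = n`.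
[cite: StacksProject, Tag 01FP] [cite: StacksProject, Tag 01FG] [cite: Godement1958, II §6.6] [cite: GortzWedhorn2023, (21.29)] -/
theorem homologyMap_pullback_cupH (hUa : ∀ s : Finset ι, s.Nonempty → IsAffineOpen (cechOpen U s)) (hcov : ⨆ i, U i = ⊤)
    (p q n : ℕ) (h : p + q = n) (x : (cechComplex U (unitModule X) ρX).homology (p : ℤ))
    (y : (cechComplex U (unitModule X) ρX).homology (q : ℤ)) :
    (HomologicalComplex.homologyMap (refineComplexMap θ (pullbackSystemHom f U V θ hθ ρX ρY hρ)) n).hom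
        (cupH (mulPairing U ρX) (isNaturalPairing_mulPairing U ρX) p q n h x y) =
      cupH (mulPairing V ρY) (isNaturalPairing_mulPairing V ρY) p q n h
        ((HomologicalComplex.homologyMap (refineComplexMap θ (pullbackSystemHom f U V θ hθ ρX ρY hρ)) p).hom x)
        ((HomologicalComplex.homologyMap (refineComplexMap θ (pullbackSystemHom f U V θ hθ ρX ρY hρ)) q).hom y) :=
  homologyMap_cupH U (unitModule X) ρX (mulPairing U ρX) (mulPairing V ρY) θ
    (pullbackSystemHom f U V θ hθ ρX ρY hρ) (pullbackSystemHom f U V θ hθ ρX ρY hρ)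
    (pullbackSystemHom f U V θ hθ ρX ρY hρ) hUa hcov IsAffineLocalizing.unit (isNaturalPairing_mulPairing U ρX)
    (isNaturalPairing_mulPairing V ρY) (pullbackSystemHom_mulPairing f U V θ hθ ρX ρY hρ)
    _ (fun k z => refineComplexMap_f_apply θ _ k z) _ (fun k z => refineComplexMap_f_apply θ _ k z)
    _ (fun k z => refineComplexMap_f_apply θ _ k z) p q n h x y

/-! ## §2 The same, for the linear maps `Ȟᵖ ⊗ Ȟᵠ → Ȟⁿ` -/

/-- **`f^*` intertwines the cup-product maps `Ȟᵖ ⊗ Ȟᵠ → Ȟⁿ`**: `f^* ∘ lift (⌣_X) = lift (⌣_Y) ∘ (f^* ⊗ f^*)` as `A`-linear maps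
(same hypotheses as `homologyMap_pullback_cupH`; the form in which statements such as «`Ȟ¹ ⊗ Ȟ¹ → Ȟ²` is onto» travel
along `f^*`). [cite: StacksProject, Tag 01FP] [cite: Godement1958, II §6.6] -/
theorem homologyMap_comp_lift_cupH (hUa : ∀ s : Finset ι, s.Nonempty → IsAffineOpen (cechOpen U s)) (hcov : ⨆ i, U i = ⊤)
    (p q n : ℕ) (h : p + q = n) :
    (HomologicalComplex.homologyMap (refineComplexMap θ (pullbackSystemHom f U V θ hθ ρX ρY hρ)) n).hom ∘ₗ
        TensorProduct.lift (cupH (mulPairing U ρX) (isNaturalPairing_mulPairing U ρX) p q n h) =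
      TensorProduct.lift (cupH (mulPairing V ρY) (isNaturalPairing_mulPairing V ρY) p q n h) ∘ₗ
        TensorProduct.map
          (HomologicalComplex.homologyMap (refineComplexMap θ (pullbackSystemHom f U V θ hθ ρX ρY hρ)) p).hom
          (HomologicalComplex.homologyMap (refineComplexMap θ (pullbackSystemHom f U V θ hθ ρX ρY hρ)) q).hom :=
  TensorProduct.ext' fun x y => by
    rw [LinearMap.comp_apply, TensorProduct.lift.tmul, LinearMap.comp_apply, TensorProduct.map_tmul,
      TensorProduct.lift.tmul]
    exact homologyMap_pullback_cupH f U V θ hθ ρX ρY hρ hUa hcov p q n h x y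

end Literature.AlgebraicGeometry.Modules

end
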